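import Literature.Probability.LatticeModels.RandomClusterBoxDuality
import Literature.Probability.Percolation.FourArmGarban
import HarnessLib

/-!
# Two dual arms across a square annulus separate the flanked sectors (bond percolation on `ℤ²`)

Topic `Literature/Probability/Percolation`; proofs only (no definition, no named fact). A
bottom-up brick for the five-arm estimates of critical bond percolation on `ℤ²`
(`zdFiveArmClusters`, `ZdFourArmFromFiveArm.lean`; `DuminilCopinManolescuTassion2021_zdFiveArm_upperBound`,
`ZdFiveArmUpperBound.lean`): the direction "two separating dual-open arms ⟹ two distinct open
annulus-clusters" of the standard dictionary between arm events and clusters on the self-dual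
square lattice (Kesten 1982, §2.2–2.3; Grimmett 1999, §11.2; quoted without proof in the docstrings
of `fourArmTwoClusters` and `zdFiveArmClusters`), which is what the gluing of well-separated
five-arm events across scales (Nolin 2008, Prop. 12 [arXiv 0711.4948: Prop. 11]; Kesten 1987)
needs in order to land in the cluster form of the tree's events.

Setting: the square annulus `A_{m,n} = {m ≤ ‖·‖_∞ ≤ n}` (`sqAnnulus m n`), faces of `ℤ²` indexed
by their lower-left corner (`Crossings.lean`, `PlanarDuality.lean`: adjacent faces `z`, `z'` are
separated by the primal edge `sepEdge z z'`).  A **dual arm** is here a walk of faces each of whose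
steps crosses a primal edge that is NOT an edge of the open walk under consideration (in the
application: a closed edge) and whose endpoints both have sup-norm `≥ m` (the arm never enters the
hole `‖·‖_∞ ≤ m - 1`); it starts at a face just inside the inner square `‖·‖_∞ = m` and ends at a
face above the level `n` (an arm "to the top") or to the right of the column `n` (an arm "to the
right").

* `walkWinding_sub_walkWinding_up_closed`, `walkWinding_closed_eq_of_faceWalk` — for CLOSED
  lattice walks the winding number (`walkWinding`, `PlanarDuality.lean`) is constant along walks of
  faces never separated by an edge of the walk, with no half-line side condition (the boundary
  terms of the flow identity cancel; one step is `walkWinding_closed_eq_of_adj`,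
  `RandomClusterBoxDuality.lean`).
* `exists_rightRun`, `exists_upRun` — straight runs with their supports, edges and edge-crossing
  sums (`hCross`, `vCross`).
* `sqAnnulus_dualArms_false` — **the combinatorial barrier lemma**: an open-type walk `P` inside
  `A_{m,n}` from a site `e` of the east inner side (`e₀ = m`, `|e₁| ≤ m - 1`) to a site `w` of the
  west inner side cannot coexist with a dual arm from the face below the inner top side at abscissa
  `x_t` to the level `n` and a dual arm from the face left of the inner east side at a height
  `y_r < e₁` to the column `n`, both avoiding the edges of `P`.  Proof (a discrete Jordan-curve
  argument by winding numbers, Kesten 1982, §2.2): close `P` up through the hole into a loop `L`;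
  `L` winds `0` around every face at level `≥ n`, hence (constancy along the two dual arms) around
  both starting faces; but moving the base face inside the hole from the first starting face to the
  second crosses the closing path exactly once, so the two winding numbers differ by one.
* `not_openConnIn_sqAnnulus_of_dualArms` — **the percolation form**: for a lattice configuration
  `ω`, two such face walks crossing only closed edges forbid `{e ↔ w in A_{m,n}}`.
* `exists_closingWalk_row`, `sqAnnulus_dualArmsTB_false`, `not_openConnIn_sqAnnulus_of_dualArmsTB`
  — **the top–bottom version** (the layout of Kesten–Sidoravicius–Zhang's `F(w, n)`: dual arms up
  and down, open arms left and right): a dual arm from the face below the inner top side to the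
  level `n` and a dual arm from the face above the inner bottom side to the level `-n - 1`, both
  avoiding the edges of `P` (resp. crossing closed edges only), are incompatible with a walk `P` of
  the annulus (resp. an open path of the annulus) from the inner east side to the inner west side;
  same proof with the closing path along the row `0` and the base face moved from `(x_t, m - 1)`
  down to `(x_t, 0)`, across the closing path to `(x_t, -1)`, along the face row `-1` and down to
  `(x_b, -m)`.

## References

* H. Kesten, *Percolation theory for mathematicians*, Birkhäuser (1982), §2.2–2.3 (planar duality,
  Whitney/Jordan arguments on the square lattice) [KestenPTM1982].
* G. Grimmett, *Percolation*, 2nd ed. (1999), §11.2 [GrimmettPercolation1999].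
* P. Nolin, *Near-critical percolation in two dimensions*, EJP 13 (2008), §4.1 (arm events and
  their cluster description), Prop. 12 [arXiv 0711.4948: Prop. 11] (gluing) [Nolin2008].

Tree: `walkWinding`, `walkWinding_sub_walkWinding_up`, `walkWinding_eq_walkWinding_right`,
`walkWinding_eq_zero_of_le`, `hCross`, `vCross`, `sepEdge`, `sepEdge_right`, `sepEdge_up`,
`stepKind_of_adj`, `adj_of_stepKind` (`PlanarDuality.lean`); `sqAnnulus` (`FourArmGarban.lean`);
`exists_walk_of_mem_openConnIn` (`PlanarDuality.lean`). Mathlib: `SimpleGraph.Walk` API.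
`walkWinding_closed_eq_up`, `walkWinding_closed_eq_of_adj` (`RandomClusterBoxDuality.lean`).
(`walkWinding_closed_eq_of_faceWalk` has a namesake in the sub-namespace `LatticeModels.SquareTiling`,
`SquareTilingModulusProofs.lean`, re-proved here in five lines rather than imported, to keep this
percolation brick off the potential-theoretic import cone of that file.)
-/

noncomputable section

namespace Literature.Probability.Percolation

open SimpleGraph LatticeModels

/-! ### Closed walks: winding constancy without half-line conditions -/

section Closed

variable {a : Site 2}

/-- For a closed lattice walk, moving the base point one step up changes the winding number only
by the signed traversals of the horizontal edge in between (the two boundary terms of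
`walkWinding_sub_walkWinding_up` cancel). [folklore] -/
theorem walkWinding_sub_walkWinding_up_closed (p : (zdGraph 2).Walk a a) (u : Site 2) :
    walkWinding p u - walkWinding p (u + Pi.single 1 1) =
      -(p.darts.map fun d => hCross u d.fst d.snd).sum := by
  have := walkWinding_sub_walkWinding_up p u
  rw [sub_self, neg_zero, zero_sub] at this
  exact this

/-- **Constancy along dual walks, closed case.** If `q` is a walk of faces such that the closed
lattice walk `p` never traverses the primal edge separating two consecutive faces of `q`, then `p`
winds equally around the two end faces of `q` (no half-line condition is needed for closed walks;
one step is `walkWinding_closed_eq_of_adj`, `RandomClusterBoxDuality.lean`).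
(Kesten 1982, §2.2.) [cite: KestenPTM1982, §2.2] -/
theorem walkWinding_closed_eq_of_faceWalk (p : (zdGraph 2).Walk a a) {c d : Site 2}
    (q : (zdGraph 2).Walk c d) (hq : ∀ dq ∈ q.darts, sepEdge dq.fst dq.snd ∉ p.edges) :
    walkWinding p c = walkWinding p d := by
  induction q with
  | nil => rfl
  | cons h q ih =>
    rename_i x y z
    rw [walkWinding_closed_eq_of_adj h (hq ⟨(x, y), h⟩ (by simp))]
    exact ih fun dq hdq => hq dq (by simp [hdq])

end Closed

/-! ### Vanishing edge-crossing sums -/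

section Sums

variable {a b : Site 2}

/-- If a lattice walk does not use the horizontal edge `{u + e₁, u + e₁ + e₀}`, the signed count
of its traversals of that edge vanishes. [folklore] -/
theorem sum_hCross_eq_zero_of_notMem {p : (zdGraph 2).Walk a b} {u : Site 2}
    (h : s(u + Pi.single 1 1, u + Pi.single 1 1 + Pi.single 0 1) ∉ p.edges) :
    (p.darts.map fun d => hCross u d.fst d.snd).sum = 0 := by
  refine List.sum_eq_zero fun t ht => ?_
  obtain ⟨d, hd, rfl⟩ := List.mem_map.1 ht
  refine hCross_eq_zero_of_ne fun heq => h ?_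
  rw [← heq]
  exact List.mem_map.2 ⟨d, hd, rfl⟩

/-- Both endpoints of an edge of a walk lie on the walk. [folklore] -/
theorem mem_support_of_mem_edges_of_mem {V : Type*} {G : SimpleGraph V} {x y : V}
    (p : G.Walk x y) {ε : Sym2 V} (hε : ε ∈ p.edges) {v : V} (hv : v ∈ ε) : v ∈ p.support := by
  induction ε using Sym2.ind with
  | h s t =>
    rcases Sym2.mem_iff.1 hv with rfl | rfl
    · exact p.fst_mem_support_of_mem_edges hε
    · exact p.snd_mem_support_of_mem_edges hε

end Sums

/-! ### Straight runs -/

section Runs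

/-- **A run to the right**: from `z`, `k` unit steps in the direction `e₀`, with its support, its
edges (all of the form `{v, v + e₀}`) and the signed count of its traversals of any horizontal
edge. [folklore] -/
theorem exists_rightRun (z : Site 2) (k : ℕ) :
    ∃ (z' : Site 2) (p : (zdGraph 2).Walk z z'), z' 0 = z 0 + k ∧ z' 1 = z 1 ∧
      (∀ v ∈ p.support, v 1 = z 1 ∧ z 0 ≤ v 0 ∧ v 0 ≤ z 0 + k) ∧
      (∀ ε ∈ p.edges, ∃ v : Site 2, ε = s(v, v + Pi.single 0 1) ∧
        v 1 = z 1 ∧ z 0 ≤ v 0 ∧ v 0 + 1 ≤ z 0 + k) ∧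
      (∀ u : Site 2, (p.darts.map fun d => hCross u d.fst d.snd).sum =
        if u 1 + 1 = z 1 ∧ z 0 ≤ u 0 ∧ u 0 + 1 ≤ z 0 + k then 1 else 0) := by
  induction k generalizing z with
  | zero =>
    refine ⟨z, Walk.nil, by simp, rfl, ?_, ?_, ?_⟩
    · intro v hv
      rw [Walk.support_nil, List.mem_singleton] at hv
      subst hv
      simp
    · intro ε hε
      simp at hε
    · intro u
      simp only [Walk.darts_nil, List.map_nil, List.sum_nil, Nat.cast_zero, add_zero]
      split_ifs with h
      · omega
      · rfl
  | succ k ih =>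
    obtain ⟨z', p, h0, h1, hs, hed, hsum⟩ := ih (z + Pi.single 0 1)
    have hadj : (zdGraph 2).Adj z (z + Pi.single 0 1) := adj_of_stepKind (.right (by simp) (by simp))
    refine ⟨z', Walk.cons hadj p, ?_, ?_, ?_, ?_, ?_⟩
    · rw [h0]; simp only [Pi.add_apply, single_zero_apply_zero, Nat.cast_succ]; ring
    · rw [h1]; simp
    · intro v hv
      rw [Walk.support_cons, List.mem_cons] at hv
      rcases hv with rfl | hv
      · refine ⟨rfl, le_rfl, ?_⟩
        have : (0 : ℤ) ≤ (k : ℤ) := Int.natCast_nonneg k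
        push_cast
        linarith
      · have := hs v hv
        simp only [Pi.add_apply, single_zero_apply_zero, single_zero_apply_one, add_zero] at this
        push_cast
        omega
    · intro ε hε
      rw [Walk.edges_cons, List.mem_cons] at hε
      rcases hε with rfl | hε
      · exact ⟨z, rfl, rfl, le_rfl, by push_cast; omega⟩
      · obtain ⟨v, rfl, hv1, hv0, hv0'⟩ := hed ε hε
        simp only [Pi.add_apply, single_zero_apply_zero, single_zero_apply_one, add_zero] at hv1 hv0 hv0'
        exact ⟨v, rfl, hv1, by omega, by push_cast; omega⟩
    · intro u
      rw [Walk.darts_cons, List.map_cons, List.sum_cons, hsum u]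
      unfold hCross
      simp only [Pi.add_apply, single_zero_apply_zero, single_zero_apply_one, add_zero, Nat.cast_succ]
      split_ifs <;> omega

/-- **A run upwards**: from `z`, `k` unit steps in the direction `e₁`, with its support and its
edges (all of the form `{v, v + e₁}`). [folklore] -/
theorem exists_upRun (z : Site 2) (k : ℕ) :
    ∃ (z' : Site 2) (p : (zdGraph 2).Walk z z'), z' 0 = z 0 ∧ z' 1 = z 1 + k ∧
      (∀ v ∈ p.support, v 0 = z 0 ∧ z 1 ≤ v 1 ∧ v 1 ≤ z 1 + k) ∧
      (∀ ε ∈ p.edges, ∃ v : Site 2, ε = s(v, v + Pi.single 1 1) ∧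
        v 0 = z 0 ∧ z 1 ≤ v 1 ∧ v 1 + 1 ≤ z 1 + k) := by
  induction k generalizing z with
  | zero =>
    refine ⟨z, Walk.nil, rfl, by simp, ?_, ?_⟩
    · intro v hv
      rw [Walk.support_nil, List.mem_singleton] at hv
      subst hv
      simp
    · intro ε hε
      simp at hε
  | succ k ih =>
    obtain ⟨z', p, h0, h1, hs, hed⟩ := ih (z + Pi.single 1 1)
    have hadj : (zdGraph 2).Adj z (z + Pi.single 1 1) := adj_of_stepKind (.up (by simp) (by simp))
    refine ⟨z', Walk.cons hadj p, ?_, ?_, ?_, ?_⟩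
    · rw [h0]; simp
    · rw [h1]; simp only [Pi.add_apply, single_one_apply_one, Nat.cast_succ]; ring
    · intro v hv
      rw [Walk.support_cons, List.mem_cons] at hv
      rcases hv with rfl | hv
      · refine ⟨rfl, le_rfl, ?_⟩
        have : (0 : ℤ) ≤ (k : ℤ) := Int.natCast_nonneg k
        push_cast
        linarith
      · have := hs v hv
        simp only [Pi.add_apply, single_one_apply_zero, single_one_apply_one, add_zero] at this
        push_cast
        omega
    · intro ε hε
      rw [Walk.edges_cons, List.mem_cons] at hε
      rcases hε with rfl | hε
      · exact ⟨z, rfl, rfl, le_rfl, by push_cast; omega⟩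
      · obtain ⟨v, rfl, hv0, hv1, hv1'⟩ := hed ε hε
        simp only [Pi.add_apply, single_one_apply_zero, single_one_apply_one, add_zero] at hv0 hv1 hv1'
        exact ⟨v, rfl, hv0, by omega, by push_cast; omega⟩

/-- A run to the right between two given sites of the same row. [folklore] -/
theorem exists_rightRun_to {z z' : Site 2} (h1 : z' 1 = z 1) (h0 : z 0 ≤ z' 0) :
    ∃ p : (zdGraph 2).Walk z z',
      (∀ v ∈ p.support, v 1 = z 1 ∧ z 0 ≤ v 0 ∧ v 0 ≤ z' 0) ∧
      (∀ ε ∈ p.edges, ∃ v : Site 2, ε = s(v, v + Pi.single 0 1) ∧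
        v 1 = z 1 ∧ z 0 ≤ v 0 ∧ v 0 + 1 ≤ z' 0) ∧
      (∀ u : Site 2, (p.darts.map fun d => hCross u d.fst d.snd).sum =
        if u 1 + 1 = z 1 ∧ z 0 ≤ u 0 ∧ u 0 + 1 ≤ z' 0 then 1 else 0) := by
  obtain ⟨z'', p, h0'', h1'', hs, hed, hsum⟩ := exists_rightRun z (z' 0 - z 0).toNat
  have hk : (((z' 0 - z 0).toNat : ℕ) : ℤ) = z' 0 - z 0 := Int.toNat_of_nonneg (by omega)
  rw [hk] at h0''
  obtain rfl : z'' = z' := by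
    rw [Site.eq_iff_two]; constructor <;> omega
  simp only [hk] at hs hed hsum
  refine ⟨p, fun v hv => ?_, fun ε hε => ?_, fun u => ?_⟩
  · have := hs v hv; omega
  · obtain ⟨v, rfl, hv1, hv0, hv0'⟩ := hed ε hε
    exact ⟨v, rfl, hv1, hv0, by omega⟩
  · rw [hsum u]
    split_ifs <;> omega

/-- A vertical run between two given sites of the same column (in either direction). [folklore] -/
theorem exists_vRun {z z' : Site 2} (h0 : z' 0 = z 0) :
    ∃ p : (zdGraph 2).Walk z z',
      (∀ v ∈ p.support, v 0 = z 0 ∧ min (z 1) (z' 1) ≤ v 1 ∧ v 1 ≤ max (z 1) (z' 1)) ∧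
      (∀ ε ∈ p.edges, ∃ v : Site 2, ε = s(v, v + Pi.single 1 1) ∧
        v 0 = z 0 ∧ min (z 1) (z' 1) ≤ v 1 ∧ v 1 + 1 ≤ max (z 1) (z' 1)) := by
  rcases le_total (z 1) (z' 1) with hle | hle
  · obtain ⟨z'', p, h0'', h1'', hs, hed⟩ := exists_upRun z (z' 1 - z 1).toNat
    have hk : (((z' 1 - z 1).toNat : ℕ) : ℤ) = z' 1 - z 1 := Int.toNat_of_nonneg (by omega)
    rw [hk] at h1''
    obtain rfl : z'' = z' := by
      rw [Site.eq_iff_two]; constructor <;> omega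
    simp only [hk] at hs hed
    refine ⟨p, fun v hv => ?_, fun ε hε => ?_⟩
    · have := hs v hv
      rw [min_eq_left hle, max_eq_right hle]
      omega
    · obtain ⟨v, rfl, hv0, hv1, hv1'⟩ := hed ε hε
      rw [min_eq_left hle, max_eq_right hle]
      exact ⟨v, rfl, hv0, hv1, by omega⟩
  · obtain ⟨z'', p, h0'', h1'', hs, hed⟩ := exists_upRun z' (z 1 - z' 1).toNat
    have hk : (((z 1 - z' 1).toNat : ℕ) : ℤ) = z 1 - z' 1 := Int.toNat_of_nonneg (by omega)
    rw [hk] at h1''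
    obtain rfl : z'' = z := by
      rw [Site.eq_iff_two]; constructor <;> omega
    simp only [hk] at hs hed
    refine ⟨p.reverse, fun v hv => ?_, fun ε hε => ?_⟩
    · rw [Walk.support_reverse, List.mem_reverse] at hv
      have := hs v hv
      rw [min_eq_right hle, max_eq_left hle]
      omega
    · rw [Walk.edges_reverse, List.mem_reverse] at hε
      obtain ⟨v, rfl, hv0, hv1, hv1'⟩ := hed ε hε
      rw [min_eq_right hle, max_eq_left hle]
      exact ⟨v, rfl, by omega, hv1, by omega⟩

end Runs

/-! ### Comparing unit edges -/

section Edges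

/-- Two horizontal unit edges coincide iff their left endpoints do. [folklore] -/
theorem mk_add_single_zero_eq_iff {A v : Site 2} :
    s(A, A + Pi.single 0 1) = s(v, v + Pi.single 0 1) ↔ A = v := by
  constructor
  · intro h
    rcases Sym2.eq_iff.1 h with ⟨h1, -⟩ | ⟨h1, h2⟩
    · exact h1
    · exfalso
      have e1 := congr_fun h1 0
      have e2 := congr_fun h2 0
      simp only [Pi.add_apply, single_zero_apply_zero] at e1 e2
      omega
  · rintro rfl; rfl

/-- Two vertical unit edges coincide iff their lower endpoints do. [folklore] -/
theorem mk_add_single_one_eq_iff {A v : Site 2} :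
    s(A, A + Pi.single 1 1) = s(v, v + Pi.single 1 1) ↔ A = v := by
  constructor
  · intro h
    rcases Sym2.eq_iff.1 h with ⟨h1, -⟩ | ⟨h1, h2⟩
    · exact h1
    · exfalso
      have e1 := congr_fun h1 1
      have e2 := congr_fun h2 1
      simp only [Pi.add_apply, single_one_apply_one] at e1 e2
      omega
  · rintro rfl; rfl

/-- A horizontal unit edge is not a vertical unit edge. [folklore] -/
theorem mk_add_single_zero_ne_mk_add_single_one (A v : Site 2) :
    s(A, A + Pi.single 0 1) ≠ s(v, v + Pi.single 1 1) := by
  intro h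
  rcases Sym2.eq_iff.1 h with ⟨h1, h2⟩ | ⟨h1, h2⟩
  · have e1 := congr_fun h1 0
    have e2 := congr_fun h2 0
    simp only [Pi.add_apply, single_zero_apply_zero, single_one_apply_zero, add_zero] at e1 e2
    omega
  · have e1 := congr_fun h1 0
    have e2 := congr_fun h2 0
    simp only [Pi.add_apply, single_zero_apply_zero, single_one_apply_zero, add_zero] at e1 e2
    omega

end Edges

/-! ### The closing path through the hole -/

section Closing

/-- **The closing path.** For `m ≥ 2`, a site `w` of the west side of the square `‖·‖_∞ = m`
(`w₀ = -m`, `|w₁| ≤ m - 1`), a site `e` of its east side (`e₀ = m`, `|e₁| ≤ m - 1`) and an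
abscissa `x_t ∈ [-m + 1, m - 2]`, there is a lattice walk from `w` to `e` through the hole
`‖·‖_∞ ≤ m - 1` — one step east, up the column `-m + 1` to the row `m - 1`, east along that row to
the column `x_t`, along the column `x_t` to the row `e₁`, east along that row to `e` — all of
whose edges have an endpoint in the hole, whose horizontal edges in the column `x_t` (left
endpoint abscissa `x_t`) lie on the row `e₁` only, whose vertical edges lie in the columns
`-m + 1` and `x_t` only, and which traverses the edge `{(x_t, e₁), (x_t + 1, e₁)}` exactly once,
eastwards. [folklore] -/
theorem exists_closingWalk {m : ℕ} (hm : 2 ≤ m) {w e : Site 2} (hw0 : w 0 = -(m : ℤ))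
    (hw1 : |w 1| ≤ (m : ℤ) - 1) (he0 : e 0 = m) (he1 : |e 1| ≤ (m : ℤ) - 1)
    {xt : ℤ} (hxt : -(m : ℤ) + 1 ≤ xt) (hxt' : xt ≤ (m : ℤ) - 2) :
    ∃ Γ : (zdGraph 2).Walk w e,
      (∀ v ∈ Γ.support, ∀ i, -(m : ℤ) ≤ v i ∧ v i ≤ m) ∧
      (∀ ε ∈ Γ.edges, ∃ v ∈ ε, ∀ i, -((m : ℤ) - 1) ≤ v i ∧ v i ≤ (m : ℤ) - 1) ∧
      (∀ ε ∈ Γ.edges,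
        (∃ v : Site 2, ε = s(v, v + Pi.single 0 1) ∧
          ((v 1 = w 1 ∧ v 0 = -(m : ℤ)) ∨ (v 1 = (m : ℤ) - 1 ∧ v 0 + 1 ≤ xt) ∨
            (v 1 = e 1 ∧ xt ≤ v 0))) ∨
        (∃ v : Site 2, ε = s(v, v + Pi.single 1 1) ∧ (v 0 = -(m : ℤ) + 1 ∨ v 0 = xt))) ∧
      (∀ u : Site 2, u 0 = xt → u 1 + 1 = e 1 →
        (Γ.darts.map fun d => hCross u d.fst d.snd).sum = 1) := by
  rw [abs_le] at hw1 he1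
  -- the corner points of the closing path
  set z₁ : Site 2 := w + Pi.single 0 1 with hz₁
  set z₂ : Site 2 := ![-(m : ℤ) + 1, (m : ℤ) - 1] with hz₂
  set z₃ : Site 2 := ![xt, (m : ℤ) - 1] with hz₃
  set z₄ : Site 2 := ![xt, e 1] with hz₄
  have hz₁0 : z₁ 0 = -(m : ℤ) + 1 := by simp [hz₁, hw0]
  have hz₁1 : z₁ 1 = w 1 := by simp [hz₁]
  have hz₂0 : z₂ 0 = -(m : ℤ) + 1 := by simp [hz₂]
  have hz₂1 : z₂ 1 = (m : ℤ) - 1 := by simp [hz₂]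
  have hz₃0 : z₃ 0 = xt := by simp [hz₃]
  have hz₃1 : z₃ 1 = (m : ℤ) - 1 := by simp [hz₃]
  have hz₄0 : z₄ 0 = xt := by simp [hz₄]
  have hz₄1 : z₄ 1 = e 1 := by simp [hz₄]
  -- the five runs
  obtain ⟨γ₁, hs₁, hed₁, hsum₁⟩ := exists_rightRun_to (z := w) (z' := z₁) hz₁1 (by rw [hz₁0, hw0]; omega)
  obtain ⟨γ₂, hs₂, hed₂⟩ := exists_vRun (z := z₁) (z' := z₂) (by rw [hz₂0, hz₁0])
  obtain ⟨γ₃, hs₃, hed₃, hsum₃⟩ := exists_rightRun_to (z := z₂) (z' := z₃) (by rw [hz₃1, hz₂1])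
    (by rw [hz₂0, hz₃0]; omega)
  obtain ⟨γ₄, hs₄, hed₄⟩ := exists_vRun (z := z₃) (z' := z₄) (by rw [hz₄0, hz₃0])
  obtain ⟨γ₅, hs₅, hed₅, hsum₅⟩ := exists_rightRun_to (z := z₄) (z' := e) (by rw [hz₄1])
    (by rw [hz₄0, he0]; omega)
  have hmin₂ : min (z₁ 1) (z₂ 1) = w 1 := by rw [hz₁1, hz₂1]; exact min_eq_left hw1.2
  have hmax₂ : max (z₁ 1) (z₂ 1) = (m : ℤ) - 1 := by rw [hz₁1, hz₂1]; exact max_eq_right hw1.2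
  have hmin₄ : min (z₃ 1) (z₄ 1) = e 1 := by rw [hz₃1, hz₄1]; exact min_eq_right he1.2
  have hmax₄ : max (z₃ 1) (z₄ 1) = (m : ℤ) - 1 := by rw [hz₃1, hz₄1]; exact max_eq_left he1.2
  simp only [hmin₂, hmax₂] at hs₂ hed₂
  simp only [hmin₄, hmax₄] at hs₄ hed₄
  refine ⟨γ₁.append (γ₂.append (γ₃.append (γ₄.append γ₅))), ?_, ?_, ?_, ?_⟩
  · -- support
    intro v hv
    rw [Fin.forall_fin_two]
    rw [Walk.mem_support_append_iff, Walk.mem_support_append_iff, Walk.mem_support_append_iff,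
      Walk.mem_support_append_iff] at hv
    rcases hv with hv | hv | hv | hv | hv
    · have h := hs₁ v hv
      rw [hz₁0] at h
      constructor <;> constructor <;> omega
    · have h := hs₂ v hv
      rw [hz₁0] at h
      constructor <;> constructor <;> omega
    · have h := hs₃ v hv
      rw [hz₂0, hz₂1, hz₃0] at h
      constructor <;> constructor <;> omega
    · have h := hs₄ v hv
      rw [hz₃0] at h
      constructor <;> constructor <;> omega
    · have h := hs₅ v hv
      rw [hz₄0, hz₄1, he0] at h
      constructor <;> constructor <;> omega
  · -- every edge has an endpoint in the hole
    intro ε hε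
    simp only [Walk.edges_append, List.mem_append] at hε
    rcases hε with hε | hε | hε | hε | hε
    · obtain ⟨v, rfl, hv1, hv0, hv0'⟩ := hed₁ ε hε
      rw [hz₁0] at hv0'
      refine ⟨v + Pi.single 0 1, Sym2.mem_mk_right _ _, ?_⟩
      rw [Fin.forall_fin_two]
      simp only [Pi.add_apply, single_zero_apply_zero, single_zero_apply_one, add_zero]
      constructor <;> constructor <;> omega
    · obtain ⟨v, rfl, hv0, hv1, hv1'⟩ := hed₂ ε hε
      rw [hz₁0] at hv0
      refine ⟨v, Sym2.mem_mk_left _ _, ?_⟩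
      rw [Fin.forall_fin_two]
      constructor <;> constructor <;> omega
    · obtain ⟨v, rfl, hv1, hv0, hv0'⟩ := hed₃ ε hε
      rw [hz₂1] at hv1
      rw [hz₂0] at hv0
      rw [hz₃0] at hv0'
      refine ⟨v, Sym2.mem_mk_left _ _, ?_⟩
      rw [Fin.forall_fin_two]
      constructor <;> constructor <;> omega
    · obtain ⟨v, rfl, hv0, hv1, hv1'⟩ := hed₄ ε hε
      rw [hz₃0] at hv0
      refine ⟨v, Sym2.mem_mk_left _ _, ?_⟩
      rw [Fin.forall_fin_two]
      constructor <;> constructor <;> omega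
    · obtain ⟨v, rfl, hv1, hv0, hv0'⟩ := hed₅ ε hε
      rw [hz₄1] at hv1
      rw [hz₄0] at hv0
      rw [he0] at hv0'
      refine ⟨v, Sym2.mem_mk_left _ _, ?_⟩
      rw [Fin.forall_fin_two]
      constructor <;> constructor <;> omega
  · -- the shape of the edges
    intro ε hε
    simp only [Walk.edges_append, List.mem_append] at hε
    rcases hε with hε | hε | hε | hε | hε
    · obtain ⟨v, rfl, hv1, hv0, hv0'⟩ := hed₁ ε hε
      rw [hz₁0] at hv0'
      exact Or.inl ⟨v, rfl, Or.inl ⟨hv1, by omega⟩⟩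
    · obtain ⟨v, rfl, hv0, hv1, hv1'⟩ := hed₂ ε hε
      rw [hz₁0] at hv0
      exact Or.inr ⟨v, rfl, Or.inl hv0⟩
    · obtain ⟨v, rfl, hv1, hv0, hv0'⟩ := hed₃ ε hε
      rw [hz₂1] at hv1
      rw [hz₃0] at hv0'
      exact Or.inl ⟨v, rfl, Or.inr (Or.inl ⟨hv1, hv0'⟩)⟩
    · obtain ⟨v, rfl, hv0, hv1, hv1'⟩ := hed₄ ε hε
      rw [hz₃0] at hv0
      exact Or.inr ⟨v, rfl, Or.inr hv0⟩
    · obtain ⟨v, rfl, hv1, hv0, hv0'⟩ := hed₅ ε hε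
      rw [hz₄1] at hv1
      rw [hz₄0] at hv0
      exact Or.inl ⟨v, rfl, Or.inr (Or.inr ⟨hv1, hv0⟩)⟩
  · -- the signed count of traversals of `{(x_t, e₁), (x_t + 1, e₁)}`
    intro u hu0 hu1
    have h₂ : s(u + Pi.single 1 1, u + Pi.single 1 1 + Pi.single 0 1) ∉ γ₂.edges := by
      intro hmem
      obtain ⟨v, hv, -⟩ := hed₂ _ hmem
      exact mk_add_single_zero_ne_mk_add_single_one _ _ hv
    have h₄ : s(u + Pi.single 1 1, u + Pi.single 1 1 + Pi.single 0 1) ∉ γ₄.edges := by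
      intro hmem
      obtain ⟨v, hv, -⟩ := hed₄ _ hmem
      exact mk_add_single_zero_ne_mk_add_single_one _ _ hv
    simp only [Walk.darts_append, List.map_append, List.sum_append, hsum₁ u, hsum₃ u, hsum₅ u,
      sum_hCross_eq_zero_of_notMem h₂, sum_hCross_eq_zero_of_notMem h₄, hz₁0, hz₂0, hz₂1, hz₃0,
      hz₄0, hz₄1, he0]
    split_ifs <;> omega

end Closing

/-! ### Moving the base point along a column or a row -/

section Moves

variable {a b : Site 2}

/-- Coordinates of `Pi.single 0 t`. [folklore] -/
@[simp] theorem single_zero_int_apply_zero (t : ℤ) : (Pi.single 0 t : Site 2) 0 = t := rfl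
/-- Coordinates of `Pi.single 0 t`. [folklore] -/
@[simp] theorem single_zero_int_apply_one (t : ℤ) : (Pi.single 0 t : Site 2) 1 = 0 := rfl
/-- Coordinates of `Pi.single 1 t`. [folklore] -/
@[simp] theorem single_one_int_apply_zero (t : ℤ) : (Pi.single 1 t : Site 2) 0 = 0 := rfl
/-- Coordinates of `Pi.single 1 t`. [folklore] -/
@[simp] theorem single_one_int_apply_one (t : ℤ) : (Pi.single 1 t : Site 2) 1 = t := rfl

/-- **Climbing a column.** If none of the horizontal edges `{u + (j+1) e₁, u + (j+1) e₁ + e₀}`,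
`j < k`, is an edge of the closed walk `L`, then `L` winds equally around `u` and `u + k e₁`.
[folklore] -/
theorem walkWinding_eq_climb (L : (zdGraph 2).Walk a a) (u : Site 2) (k : ℕ)
    (h : ∀ j : ℕ, j < k →
      s(u + Pi.single 1 ((j : ℤ) + 1), u + Pi.single 1 ((j : ℤ) + 1) + Pi.single 0 1) ∉ L.edges) :
    walkWinding L u = walkWinding L (u + Pi.single 1 (k : ℤ)) := by
  induction k with
  | zero => simp
  | succ k ih =>
    rw [ih fun j hj => h j (Nat.lt_succ_of_lt hj)]
    have hk := h k (Nat.lt_succ_self k)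
    have heq : u + Pi.single 1 ((k : ℤ) + 1) = u + Pi.single 1 (k : ℤ) + Pi.single 1 1 := by
      rw [add_assoc, ← Pi.single_add]
    rw [heq] at hk
    rw [walkWinding_closed_eq_up hk, Nat.cast_succ, heq]

/-- **Sliding along a row.** If none of the vertical edges `{u + (j+1) e₀, u + (j+1) e₀ + e₁}`,
`j < k`, is an edge of the walk `L`, then `L` winds equally around `u` and `u + k e₀`. [folklore] -/
theorem walkWinding_eq_slide (L : (zdGraph 2).Walk a b) (u : Site 2) (k : ℕ)
    (h : ∀ j : ℕ, j < k →
      s(u + Pi.single 0 ((j : ℤ) + 1), u + Pi.single 0 ((j : ℤ) + 1) + Pi.single 1 1) ∉ L.edges) :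
    walkWinding L u = walkWinding L (u + Pi.single 0 (k : ℤ)) := by
  induction k with
  | zero => simp
  | succ k ih =>
    rw [ih fun j hj => h j (Nat.lt_succ_of_lt hj)]
    have hk := h k (Nat.lt_succ_self k)
    have heq : u + Pi.single 0 ((k : ℤ) + 1) = u + Pi.single 0 (k : ℤ) + Pi.single 0 1 := by
      rw [add_assoc, ← Pi.single_add]
    rw [heq] at hk
    rw [walkWinding_eq_walkWinding_right hk, Nat.cast_succ, heq]

end Moves

/-! ### The barrier lemma -/

section Barrier

/-- **Two dual arms across the square annulus separate the flanked inner sites** (the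
combinatorial core).  Let `2 ≤ m ≤ n`, let `P` be a lattice walk inside `A_{m,n} = {m ≤ ‖·‖_∞ ≤ n}`
from a site `e` of the east side of the inner square (`e₀ = m`, `|e₁| ≤ m - 1`) to a site `w` of
its west side (`w₀ = -m`, `|w₁| ≤ m - 1`).  Let `δ₁` be a walk of faces from the face
`c₁ = (x_t, m - 1)` just below the inner top side (`-m + 1 ≤ x_t ≤ m - 2`) to a face at level
`≥ n`, and `δ₂` a walk of faces from the face `c₂ = (m - 1, y_r)` just left of the inner east side,
at a height `-m + 1 ≤ y_r ≤ e₁ - 1` below `e`, to a face in a column `≥ n`; suppose every step of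
`δ₁`, `δ₂` crosses a primal edge which is not an edge of `P` and both of whose endpoints lie off
the hole `‖·‖_∞ ≤ m - 1`.  This is impossible.  (In words: a dual arm from the top of the hole and
one from the east side of the hole below `e` cut the annulus into two sectors, `e` in one and the
whole west side in the other; discrete Jordan curve theorem by winding numbers, Kesten 1982, §2.2;
the cluster reading of arm events, Nolin 2008, §4.1.) [cite: KestenPTM1982, §2.2–2.3 (planar duality on the square lattice)] -/
theorem sqAnnulus_dualArms_false {m n : ℕ} (hm : 2 ≤ m) (hmn : m ≤ n)
    {e w : Site 2} (P : (zdGraph 2).Walk e w) (hP : ∀ z ∈ P.support, z ∈ sqAnnulus m n)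
    (he0 : e 0 = m) (he1 : |e 1| ≤ (m : ℤ) - 1) (hw0 : w 0 = -(m : ℤ)) (hw1 : |w 1| ≤ (m : ℤ) - 1)
    {c₁ d₁ : Site 2} (δ₁ : (zdGraph 2).Walk c₁ d₁)
    (hc₁ : -(m : ℤ) + 1 ≤ c₁ 0 ∧ c₁ 0 ≤ (m : ℤ) - 2 ∧ c₁ 1 = (m : ℤ) - 1) (hd₁ : (n : ℤ) ≤ d₁ 1)
    (hδ₁ : ∀ dq ∈ δ₁.darts, sepEdge dq.fst dq.snd ∉ P.edges ∧
      ∀ v ∈ sepEdge dq.fst dq.snd, v ∉ box 2 (m - 1))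
    {c₂ d₂ : Site 2} (δ₂ : (zdGraph 2).Walk c₂ d₂)
    (hc₂ : c₂ 0 = (m : ℤ) - 1 ∧ -(m : ℤ) + 1 ≤ c₂ 1 ∧ c₂ 1 + 1 ≤ e 1) (hd₂ : (n : ℤ) ≤ d₂ 0)
    (hδ₂ : ∀ dq ∈ δ₂.darts, sepEdge dq.fst dq.snd ∉ P.edges ∧
      ∀ v ∈ sepEdge dq.fst dq.snd, v ∉ box 2 (m - 1)) : False := by
  have hm1 : ((m - 1 : ℕ) : ℤ) = (m : ℤ) - 1 := by omega
  have habs_e := abs_le.1 he1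
  have habs_w := abs_le.1 hw1
  -- coordinates of the sites of `P`
  have hPc : ∀ z ∈ P.support, (∀ i, -(n : ℤ) ≤ z i ∧ z i ≤ n) ∧
      ¬ ∀ i, -((m : ℤ) - 1) ≤ z i ∧ z i ≤ (m : ℤ) - 1 := by
    intro z hz
    have := hP z hz
    simp only [sqAnnulus, Finset.mem_coe, mem_annulus, mem_box, hm1] at this
    exact this
  -- an edge with an endpoint in the hole is not an edge of `P`
  have hPe : ∀ ε ∈ P.edges, ∀ v ∈ ε, (∀ i, -((m : ℤ) - 1) ≤ v i ∧ v i ≤ (m : ℤ) - 1) → False :=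
    fun ε hε v hv hvin => (hPc v (mem_support_of_mem_edges_of_mem P hε hv)).2 hvin
  -- the closing path and the loop
  obtain ⟨Γ, hΓs, hΓhole, hΓshape, hΓsum⟩ := exists_closingWalk hm hw0 hw1 he0 he1 hc₁.1 hc₁.2.1
  set L := P.append Γ with hL
  have hLtop : ∀ z ∈ L.support, z 1 ≤ n := by
    intro z hz
    rw [hL, Walk.mem_support_append_iff] at hz
    rcases hz with hz | hz
    · exact ((hPc z hz).1 1).2
    · have := (hΓs z hz 1).2; omega
  have hLedges : ∀ ε ∈ L.edges,
      ε ∈ P.edges ∨ ∃ v ∈ ε, ∀ i, -((m : ℤ) - 1) ≤ v i ∧ v i ≤ (m : ℤ) - 1 := by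
    intro ε hε
    rw [hL, Walk.edges_append, List.mem_append] at hε
    rcases hε with hε | hε
    · exact Or.inl hε
    · exact Or.inr (hΓhole ε hε)
  -- an edge with both endpoints in the hole, not in `Γ`, is not in `L`
  have hLhole : ∀ (A B : Site 2), (∀ i, -((m : ℤ) - 1) ≤ A i ∧ A i ≤ (m : ℤ) - 1) →
      s(A, B) ∉ Γ.edges → s(A, B) ∉ L.edges := by
    intro A B hA hΓ hmem
    rw [hL, Walk.edges_append, List.mem_append] at hmem
    rcases hmem with hmem | hmem
    · exact hPe _ hmem A (Sym2.mem_mk_left _ _) hA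
    · exact hΓ hmem
  -- the dual arms cross no edge of the loop
  have hcross : ∀ {c d : Site 2} (δ : (zdGraph 2).Walk c d),
      (∀ dq ∈ δ.darts, sepEdge dq.fst dq.snd ∉ P.edges ∧
        ∀ v ∈ sepEdge dq.fst dq.snd, v ∉ box 2 (m - 1)) →
      ∀ dq ∈ δ.darts, sepEdge dq.fst dq.snd ∉ L.edges := by
    intro c d δ hδ dq hdq hmem
    rcases hLedges _ hmem with h | ⟨v, hv, hvin⟩
    · exact (hδ dq hdq).1 h
    · refine (hδ dq hdq).2 v hv ?_
      rw [mem_box, hm1]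
      exact hvin
  -- winding number `0` at the start of the first dual arm
  have hW₁ : walkWinding L c₁ = 0 := by
    rw [walkWinding_closed_eq_of_faceWalk L δ₁ (hcross δ₁ hδ₁)]
    exact walkWinding_eq_zero_of_le (N := n) hLtop hd₁
  -- winding number `0` at the start of the second dual arm (follow it, then climb to level `n`)
  have hW₂ : walkWinding L c₂ = 0 := by
    rw [walkWinding_closed_eq_of_faceWalk L δ₂ (hcross δ₂ hδ₂)]
    have hclimb : ∀ k : ℕ, walkWinding L d₂ = walkWinding L (d₂ + Pi.single 1 (k : ℤ)) := by
      intro k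
      refine walkWinding_eq_climb L d₂ k fun j _ hmem => ?_
      rcases hLedges _ hmem with h | ⟨v, hv, hvin⟩
      · have := ((hPc _ (P.snd_mem_support_of_mem_edges h)).1 0).2
        simp only [Pi.add_apply, single_one_int_apply_zero, add_zero, single_zero_apply_zero] at this
        omega
      · rcases Sym2.mem_iff.1 hv with rfl | rfl
        · have := (hvin 0).2
          simp only [Pi.add_apply, single_one_int_apply_zero, add_zero] at this
          omega
        · have := (hvin 0).2
          simp only [Pi.add_apply, single_one_int_apply_zero, add_zero, single_zero_apply_zero] at this
          omega
    by_cases hdn : d₂ 1 ≤ n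
    · rw [hclimb (n - d₂ 1).toNat]
      refine walkWinding_eq_zero_of_le (N := n) hLtop ?_
      simp only [Pi.add_apply, single_one_int_apply_one, Int.toNat_of_nonneg (by omega : (0 : ℤ) ≤ n - d₂ 1)]
      omega
    · exact walkWinding_eq_zero_of_le (N := n) hLtop (by omega)
  -- the base points inside the hole
  obtain ⟨uR, huR⟩ : ∃ uR : Site 2, uR = ![c₁ 0, c₂ 1] := ⟨_, rfl⟩
  obtain ⟨uS, huS⟩ : ∃ uS : Site 2, uS = ![c₁ 0, e 1 - 1] := ⟨_, rfl⟩
  obtain ⟨uN, huN⟩ : ∃ uN : Site 2, uN = ![c₁ 0, e 1] := ⟨_, rfl⟩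
  have huR0 : uR 0 = c₁ 0 := by simp [huR]
  have huR1 : uR 1 = c₂ 1 := by simp [huR]
  have huS0 : uS 0 = c₁ 0 := by simp [huS]
  have huS1 : uS 1 = e 1 - 1 := by simp [huS]
  have huN0 : uN 0 = c₁ 0 := by simp [huN]
  have huN1 : uN 1 = e 1 := by simp [huN]
  -- (A) slide along the row `c₂ 1` from `uR` to `c₂`
  have hA : walkWinding L uR = walkWinding L c₂ := by
    obtain ⟨K, hK⟩ : ∃ K : ℕ, (K : ℤ) = (m : ℤ) - 1 - c₁ 0 := ⟨_, Int.toNat_of_nonneg (by omega)⟩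
    have hend : uR + Pi.single 0 (K : ℤ) = c₂ := by
      rw [Site.eq_iff_two]
      simp only [Pi.add_apply, huR0, huR1, single_zero_int_apply_zero, single_zero_int_apply_one,
        add_zero]
      constructor <;> first | trivial | omega
    rw [← hend]
    refine walkWinding_eq_slide L uR K fun j hj => hLhole _ _ ?_ ?_
    · have hj' : (j : ℤ) < K := by exact_mod_cast hj
      rw [Fin.forall_fin_two]
      simp only [Pi.add_apply, huR0, huR1, single_zero_int_apply_zero, single_zero_int_apply_one,
        add_zero]
      constructor <;> constructor <;> omega
    · intro hmem
      rcases hΓshape _ hmem with ⟨v, hv, -⟩ | ⟨v, hv, hv0⟩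
      · exact mk_add_single_zero_ne_mk_add_single_one v _ hv.symm
      · have hA0 := congr_fun (mk_add_single_one_eq_iff.1 hv) 0
        simp only [Pi.add_apply, huR0, single_zero_int_apply_zero] at hA0
        omega
  -- (B) climb the column `c₁ 0` from `uR` to `uS` (below the crossing)
  have hB : walkWinding L uR = walkWinding L uS := by
    obtain ⟨K, hK⟩ : ∃ K : ℕ, (K : ℤ) = e 1 - 1 - c₂ 1 := ⟨_, Int.toNat_of_nonneg (by omega)⟩
    have hend : uR + Pi.single 1 (K : ℤ) = uS := by
      rw [Site.eq_iff_two]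
      simp only [Pi.add_apply, huR0, huR1, huS0, huS1, single_one_int_apply_zero,
        single_one_int_apply_one, add_zero]
      constructor <;> first | trivial | omega
    rw [← hend]
    refine walkWinding_eq_climb L uR K fun j hj => hLhole _ _ ?_ ?_
    · have hj' : (j : ℤ) < K := by exact_mod_cast hj
      rw [Fin.forall_fin_two]
      simp only [Pi.add_apply, huR0, huR1, single_one_int_apply_zero, single_one_int_apply_one,
        add_zero]
      constructor <;> constructor <;> omega
    · intro hmem
      have hj' : (j : ℤ) < K := by exact_mod_cast hj
      rcases hΓshape _ hmem with ⟨v, hv, hvc⟩ | ⟨v, hv, -⟩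
      · have hAv := mk_add_single_zero_eq_iff.1 hv
        have h0 := congr_fun hAv 0
        have h1 := congr_fun hAv 1
        simp only [Pi.add_apply, huR0, huR1, single_one_int_apply_zero, single_one_int_apply_one,
          add_zero] at h0 h1
        omega
      · exact mk_add_single_zero_ne_mk_add_single_one _ v hv
  -- (C) the crossing step
  have hC : walkWinding L uS = walkWinding L uN - 1 := by
    have hstep := walkWinding_sub_walkWinding_up_closed L uS
    have hN : uS + Pi.single 1 1 = uN := by
      rw [Site.eq_iff_two]
      simp only [Pi.add_apply, huS0, huS1, huN0, huN1, single_one_apply_zero, single_one_apply_one,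
        add_zero]
      constructor <;> first | trivial | omega
    rw [hN] at hstep
    have hsumP : (P.darts.map fun d => hCross uS d.fst d.snd).sum = 0 := by
      refine sum_hCross_eq_zero_of_notMem fun hmem => hPe _ hmem _ (Sym2.mem_mk_left _ _) ?_
      rw [Fin.forall_fin_two]
      simp only [Pi.add_apply, huS0, huS1, single_one_apply_zero, single_one_apply_one, add_zero]
      constructor <;> constructor <;> omega
    have hsumΓ : (Γ.darts.map fun d => hCross uS d.fst d.snd).sum = 1 := hΓsum uS huS0 (by omega)
    have hsumL : (L.darts.map fun d => hCross uS d.fst d.snd).sum = 1 := by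
      rw [hL, Walk.darts_append, List.map_append, List.sum_append, hsumP, hsumΓ, zero_add]
    rw [hsumL] at hstep
    linarith
  -- (D) climb the column `c₁ 0` from `uN` to `c₁` (above the crossing)
  have hD : walkWinding L uN = walkWinding L c₁ := by
    obtain ⟨K, hK⟩ : ∃ K : ℕ, (K : ℤ) = (m : ℤ) - 1 - e 1 := ⟨_, Int.toNat_of_nonneg (by omega)⟩
    have hend : uN + Pi.single 1 (K : ℤ) = c₁ := by
      rw [Site.eq_iff_two]
      simp only [Pi.add_apply, huN0, huN1, single_one_int_apply_zero, single_one_int_apply_one,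
        add_zero]
      constructor <;> first | trivial | omega
    rw [← hend]
    refine walkWinding_eq_climb L uN K fun j hj => hLhole _ _ ?_ ?_
    · have hj' : (j : ℤ) < K := by exact_mod_cast hj
      rw [Fin.forall_fin_two]
      simp only [Pi.add_apply, huN0, huN1, single_one_int_apply_zero, single_one_int_apply_one,
        add_zero]
      constructor <;> constructor <;> omega
    · intro hmem
      have hj' : (j : ℤ) < K := by exact_mod_cast hj
      rcases hΓshape _ hmem with ⟨v, hv, hvc⟩ | ⟨v, hv, -⟩
      · have hAv := mk_add_single_zero_eq_iff.1 hv
        have h0 := congr_fun hAv 0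
        have h1 := congr_fun hAv 1
        simp only [Pi.add_apply, huN0, huN1, single_one_int_apply_zero, single_one_int_apply_one,
          add_zero] at h0 h1
        omega
      · exact mk_add_single_zero_ne_mk_add_single_one _ v hv
  -- contradiction: `0 = W(c₁) = W(uN) = W(uS) + 1 = W(uR) + 1 = W(c₂) + 1 = 1`
  have : walkWinding L c₁ = walkWinding L c₂ + 1 := by
    rw [← hD, ← hA, hB, hC]; ring
  rw [hW₁, hW₂] at this
  norm_num at this

/-- **Two closed dual arms across the square annulus separate the flanked inner sites**
(percolation form of `sqAnnulus_dualArms_false`).  For a lattice configuration `ω` on `ℤ²` and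
`2 ≤ m ≤ n`: if there are a walk of faces from the face `(x_t, m - 1)` below the inner top side
(`-m + 1 ≤ x_t ≤ m - 2`) to a face at level `≥ n` and a walk of faces from the face `(m - 1, y_r)`
left of the inner east side (`-m + 1 ≤ y_r ≤ e₁ - 1`) to a face in a column `≥ n`, each step of
which crosses an `ω`-CLOSED edge with both endpoints off the hole `‖·‖_∞ ≤ m - 1` (two closed dual
arms of the annulus `A_{m,n}`, from the top side and from the east side below `e`), then the site
`e = (m, e₁)`, `|e₁| ≤ m - 1`, of the inner east side is not connected to any site `w` of the inner
west side by an `ω`-open path of `A_{m,n}`: `ω ∉ {e ↔ w in A_{m,n}}`.  This is the direction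
"separating closed dual arms ⟹ distinct open annulus-clusters" of the cluster description of the
polychromatic arm events on the self-dual lattice `ℤ²` (Nolin 2008, §4.1; Kesten 1982, §2.2–2.3),
in the form consumed by `fourArmTwoClusters` / `zdFiveArmClusters`. [cite: KestenPTM1982, §2.2–2.3 (planar duality on the square lattice)] [cite: Nolin2008, §4.1 (arm events and clusters)] -/
theorem not_openConnIn_sqAnnulus_of_dualArms {m n : ℕ} (hm : 2 ≤ m) (hmn : m ≤ n)
    {ω : BondConfig (Site 2)} (hω : ω ⊆ (zdGraph 2).edgeSet)
    {e w : Site 2} (he0 : e 0 = m) (he1 : |e 1| ≤ (m : ℤ) - 1)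
    (hw0 : w 0 = -(m : ℤ)) (hw1 : |w 1| ≤ (m : ℤ) - 1)
    {c₁ d₁ : Site 2} (δ₁ : (zdGraph 2).Walk c₁ d₁)
    (hc₁ : -(m : ℤ) + 1 ≤ c₁ 0 ∧ c₁ 0 ≤ (m : ℤ) - 2 ∧ c₁ 1 = (m : ℤ) - 1) (hd₁ : (n : ℤ) ≤ d₁ 1)
    (hδ₁ : ∀ dq ∈ δ₁.darts, sepEdge dq.fst dq.snd ∉ ω ∧
      ∀ v ∈ sepEdge dq.fst dq.snd, v ∉ box 2 (m - 1))
    {c₂ d₂ : Site 2} (δ₂ : (zdGraph 2).Walk c₂ d₂)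
    (hc₂ : c₂ 0 = (m : ℤ) - 1 ∧ -(m : ℤ) + 1 ≤ c₂ 1 ∧ c₂ 1 + 1 ≤ e 1) (hd₂ : (n : ℤ) ≤ d₂ 0)
    (hδ₂ : ∀ dq ∈ δ₂.darts, sepEdge dq.fst dq.snd ∉ ω ∧
      ∀ v ∈ sepEdge dq.fst dq.snd, v ∉ box 2 (m - 1)) :
    ω ∉ openConnIn (sqAnnulus m n) e w := by
  intro h
  obtain ⟨P, hPs, hPe⟩ := exists_walk_of_mem_openConnIn hω h
  exact sqAnnulus_dualArms_false hm hmn P hPs he0 he1 hw0 hw1 δ₁ hc₁ hd₁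
    (fun dq hdq => ⟨fun hmem => (hδ₁ dq hdq).1 (hPe _ hmem), (hδ₁ dq hdq).2⟩) δ₂ hc₂ hd₂
    (fun dq hdq => ⟨fun hmem => (hδ₂ dq hdq).1 (hPe _ hmem), (hδ₂ dq hdq).2⟩)

/-- The same separation read from the west side: `ω ∉ {w ↔ e in A_{m,n}}`. [folklore] -/
theorem not_openConnIn_sqAnnulus_of_dualArms' {m n : ℕ} (hm : 2 ≤ m) (hmn : m ≤ n)
    {ω : BondConfig (Site 2)} (hω : ω ⊆ (zdGraph 2).edgeSet)
    {e w : Site 2} (he0 : e 0 = m) (he1 : |e 1| ≤ (m : ℤ) - 1)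
    (hw0 : w 0 = -(m : ℤ)) (hw1 : |w 1| ≤ (m : ℤ) - 1)
    {c₁ d₁ : Site 2} (δ₁ : (zdGraph 2).Walk c₁ d₁)
    (hc₁ : -(m : ℤ) + 1 ≤ c₁ 0 ∧ c₁ 0 ≤ (m : ℤ) - 2 ∧ c₁ 1 = (m : ℤ) - 1) (hd₁ : (n : ℤ) ≤ d₁ 1)
    (hδ₁ : ∀ dq ∈ δ₁.darts, sepEdge dq.fst dq.snd ∉ ω ∧
      ∀ v ∈ sepEdge dq.fst dq.snd, v ∉ box 2 (m - 1))
    {c₂ d₂ : Site 2} (δ₂ : (zdGraph 2).Walk c₂ d₂)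
    (hc₂ : c₂ 0 = (m : ℤ) - 1 ∧ -(m : ℤ) + 1 ≤ c₂ 1 ∧ c₂ 1 + 1 ≤ e 1) (hd₂ : (n : ℤ) ≤ d₂ 0)
    (hδ₂ : ∀ dq ∈ δ₂.darts, sepEdge dq.fst dq.snd ∉ ω ∧
      ∀ v ∈ sepEdge dq.fst dq.snd, v ∉ box 2 (m - 1)) :
    ω ∉ openConnIn (sqAnnulus m n) w e := by
  rw [← openConnIn_comm]
  exact not_openConnIn_sqAnnulus_of_dualArms hm hmn hω he0 he1 hw0 hw1 δ₁ hc₁ hd₁ hδ₁ δ₂ hc₂ hd₂ hδ₂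

end Barrier

/-! ### The top–bottom version: a dual arm from the top of the hole and one from its bottom -/

section ClosingTB

/-- **The straight closing path.** For `m ≥ 2`, a site `w` of the west side of the square
`‖·‖_∞ = m` and a site `e` of its east side (`|w₁|, |e₁| ≤ m - 1`), there is a lattice walk from
`w` to `e` through the hole — one step east, along the column `-m + 1` to the row `0`, east along
the row `0` to the column `m - 1`, along that column to the row `e₁`, one step east — all of whose
edges have an endpoint in the hole, whose horizontal edges lie on the row `w₁` with left endpoint
abscissa `-m`, on the row `0`, or on the row `e₁` with left endpoint abscissa `m - 1`, whose
vertical edges lie in the columns `-m + 1` and `m - 1`, and which traverses every edge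
`{(x, 0), (x + 1, 0)}`, `-m + 1 ≤ x ≤ m - 2`, exactly once, eastwards. [folklore] -/
theorem exists_closingWalk_row {m : ℕ} (hm : 2 ≤ m) {w e : Site 2} (hw0 : w 0 = -(m : ℤ))
    (hw1 : |w 1| ≤ (m : ℤ) - 1) (he0 : e 0 = m) (he1 : |e 1| ≤ (m : ℤ) - 1) :
    ∃ Γ : (zdGraph 2).Walk w e,
      (∀ v ∈ Γ.support, ∀ i, -(m : ℤ) ≤ v i ∧ v i ≤ m) ∧
      (∀ ε ∈ Γ.edges, ∃ v ∈ ε, ∀ i, -((m : ℤ) - 1) ≤ v i ∧ v i ≤ (m : ℤ) - 1) ∧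
      (∀ ε ∈ Γ.edges,
        (∃ v : Site 2, ε = s(v, v + Pi.single 0 1) ∧
          ((v 1 = w 1 ∧ v 0 = -(m : ℤ)) ∨ v 1 = 0 ∨ (v 1 = e 1 ∧ v 0 = (m : ℤ) - 1))) ∨
        (∃ v : Site 2, ε = s(v, v + Pi.single 1 1) ∧ (v 0 = -(m : ℤ) + 1 ∨ v 0 = (m : ℤ) - 1))) ∧
      (∀ u : Site 2, -(m : ℤ) + 1 ≤ u 0 → u 0 + 1 ≤ (m : ℤ) - 1 → u 1 + 1 = 0 →
        (Γ.darts.map fun d => hCross u d.fst d.snd).sum = 1) := by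
  rw [abs_le] at hw1 he1
  -- the corner points of the closing path
  set z₁ : Site 2 := w + Pi.single 0 1 with hz₁
  set z₂ : Site 2 := ![-(m : ℤ) + 1, 0] with hz₂
  set z₃ : Site 2 := ![(m : ℤ) - 1, 0] with hz₃
  set z₄ : Site 2 := ![(m : ℤ) - 1, e 1] with hz₄
  have hz₁0 : z₁ 0 = -(m : ℤ) + 1 := by simp [hz₁, hw0]
  have hz₁1 : z₁ 1 = w 1 := by simp [hz₁]
  have hz₂0 : z₂ 0 = -(m : ℤ) + 1 := by simp [hz₂]
  have hz₂1 : z₂ 1 = 0 := by simp [hz₂]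
  have hz₃0 : z₃ 0 = (m : ℤ) - 1 := by simp [hz₃]
  have hz₃1 : z₃ 1 = 0 := by simp [hz₃]
  have hz₄0 : z₄ 0 = (m : ℤ) - 1 := by simp [hz₄]
  have hz₄1 : z₄ 1 = e 1 := by simp [hz₄]
  -- the five runs
  obtain ⟨γ₁, hs₁, hed₁, hsum₁⟩ := exists_rightRun_to (z := w) (z' := z₁) hz₁1 (by rw [hz₁0, hw0]; omega)
  obtain ⟨γ₂, hs₂, hed₂⟩ := exists_vRun (z := z₁) (z' := z₂) (by rw [hz₂0, hz₁0])
  obtain ⟨γ₃, hs₃, hed₃, hsum₃⟩ := exists_rightRun_to (z := z₂) (z' := z₃) (by rw [hz₃1, hz₂1])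
    (by rw [hz₂0, hz₃0]; omega)
  obtain ⟨γ₄, hs₄, hed₄⟩ := exists_vRun (z := z₃) (z' := z₄) (by rw [hz₄0, hz₃0])
  obtain ⟨γ₅, hs₅, hed₅, hsum₅⟩ := exists_rightRun_to (z := z₄) (z' := e) (by rw [hz₄1])
    (by rw [hz₄0, he0]; omega)
  have hlo₂ : -((m : ℤ) - 1) ≤ min (z₁ 1) (z₂ 1) := by rw [hz₁1, hz₂1, le_min_iff]; omega
  have hhi₂ : max (z₁ 1) (z₂ 1) ≤ (m : ℤ) - 1 := by rw [hz₁1, hz₂1, max_le_iff]; omega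
  have hlo₄ : -((m : ℤ) - 1) ≤ min (z₃ 1) (z₄ 1) := by rw [hz₃1, hz₄1, le_min_iff]; omega
  have hhi₄ : max (z₃ 1) (z₄ 1) ≤ (m : ℤ) - 1 := by rw [hz₃1, hz₄1, max_le_iff]; omega
  refine ⟨γ₁.append (γ₂.append (γ₃.append (γ₄.append γ₅))), ?_, ?_, ?_, ?_⟩
  · -- support
    intro v hv
    rw [Fin.forall_fin_two]
    rw [Walk.mem_support_append_iff, Walk.mem_support_append_iff, Walk.mem_support_append_iff,
      Walk.mem_support_append_iff] at hv
    rcases hv with hv | hv | hv | hv | hv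
    · have h := hs₁ v hv
      rw [hz₁0] at h
      constructor <;> constructor <;> omega
    · have h := hs₂ v hv
      rw [hz₁0] at h
      constructor <;> constructor <;> omega
    · have h := hs₃ v hv
      rw [hz₂0, hz₂1, hz₃0] at h
      constructor <;> constructor <;> omega
    · have h := hs₄ v hv
      rw [hz₃0] at h
      constructor <;> constructor <;> omega
    · have h := hs₅ v hv
      rw [hz₄0, hz₄1, he0] at h
      constructor <;> constructor <;> omega
  · -- every edge has an endpoint in the hole
    intro ε hε
    simp only [Walk.edges_append, List.mem_append] at hε
    rcases hε with hε | hε | hε | hε | hε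
    · obtain ⟨v, rfl, hv1, hv0, hv0'⟩ := hed₁ ε hε
      rw [hz₁0] at hv0'
      refine ⟨v + Pi.single 0 1, Sym2.mem_mk_right _ _, ?_⟩
      rw [Fin.forall_fin_two]
      simp only [Pi.add_apply, single_zero_apply_zero, single_zero_apply_one, add_zero]
      constructor <;> constructor <;> omega
    · obtain ⟨v, rfl, hv0, hv1, hv1'⟩ := hed₂ ε hε
      rw [hz₁0] at hv0
      refine ⟨v, Sym2.mem_mk_left _ _, ?_⟩
      rw [Fin.forall_fin_two]
      constructor <;> constructor <;> omega
    · obtain ⟨v, rfl, hv1, hv0, hv0'⟩ := hed₃ ε hε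
      rw [hz₂1] at hv1
      rw [hz₂0] at hv0
      rw [hz₃0] at hv0'
      refine ⟨v, Sym2.mem_mk_left _ _, ?_⟩
      rw [Fin.forall_fin_two]
      constructor <;> constructor <;> omega
    · obtain ⟨v, rfl, hv0, hv1, hv1'⟩ := hed₄ ε hε
      rw [hz₃0] at hv0
      refine ⟨v, Sym2.mem_mk_left _ _, ?_⟩
      rw [Fin.forall_fin_two]
      constructor <;> constructor <;> omega
    · obtain ⟨v, rfl, hv1, hv0, hv0'⟩ := hed₅ ε hε
      rw [hz₄1] at hv1
      rw [hz₄0] at hv0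
      rw [he0] at hv0'
      refine ⟨v, Sym2.mem_mk_left _ _, ?_⟩
      rw [Fin.forall_fin_two]
      constructor <;> constructor <;> omega
  · -- the shape of the edges
    intro ε hε
    simp only [Walk.edges_append, List.mem_append] at hε
    rcases hε with hε | hε | hε | hε | hε
    · obtain ⟨v, rfl, hv1, hv0, hv0'⟩ := hed₁ ε hε
      rw [hz₁0] at hv0'
      exact Or.inl ⟨v, rfl, Or.inl ⟨hv1, by omega⟩⟩
    · obtain ⟨v, rfl, hv0, hv1, hv1'⟩ := hed₂ ε hε
      rw [hz₁0] at hv0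
      exact Or.inr ⟨v, rfl, Or.inl hv0⟩
    · obtain ⟨v, rfl, hv1, hv0, hv0'⟩ := hed₃ ε hε
      rw [hz₂1] at hv1
      exact Or.inl ⟨v, rfl, Or.inr (Or.inl hv1)⟩
    · obtain ⟨v, rfl, hv0, hv1, hv1'⟩ := hed₄ ε hε
      rw [hz₃0] at hv0
      exact Or.inr ⟨v, rfl, Or.inr hv0⟩
    · obtain ⟨v, rfl, hv1, hv0, hv0'⟩ := hed₅ ε hε
      rw [hz₄1] at hv1
      rw [hz₄0] at hv0
      rw [he0] at hv0'
      exact Or.inl ⟨v, rfl, Or.inr (Or.inr ⟨hv1, by omega⟩)⟩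
  · -- the signed count of traversals of `{(u₀, 0), (u₀ + 1, 0)}`
    intro u hu0 hu0' hu1
    have h₂ : s(u + Pi.single 1 1, u + Pi.single 1 1 + Pi.single 0 1) ∉ γ₂.edges := by
      intro hmem
      obtain ⟨v, hv, -⟩ := hed₂ _ hmem
      exact mk_add_single_zero_ne_mk_add_single_one _ _ hv
    have h₄ : s(u + Pi.single 1 1, u + Pi.single 1 1 + Pi.single 0 1) ∉ γ₄.edges := by
      intro hmem
      obtain ⟨v, hv, -⟩ := hed₄ _ hmem
      exact mk_add_single_zero_ne_mk_add_single_one _ _ hv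
    simp only [Walk.darts_append, List.map_append, List.sum_append, hsum₁ u, hsum₃ u, hsum₅ u,
      sum_hCross_eq_zero_of_notMem h₂, sum_hCross_eq_zero_of_notMem h₄, hz₁0, hz₂0, hz₂1, hz₃0,
      hz₄0, hz₄1, he0, hw0]
    split_ifs <;> omega

end ClosingTB

section BarrierTB

/-- **A dual arm from the top of the hole and a dual arm from its bottom separate the west inner
side from the east inner side** (combinatorial core; the layout of Kesten–Sidoravicius–Zhang's
five-arm event `F(w, n)` and of `zdFiveArmKSZ`).  Let `2 ≤ m ≤ n`, let `P` be a lattice walk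
inside `A_{m,n}` from a site `e` of the east inner side (`e₀ = m`, `|e₁| ≤ m - 1`) to a site `w`
of the west inner side.  Let `δ₁` be a walk of faces from the face `c₁ = (x_t, m - 1)` just below
the inner top side to a face at level `≥ n`, and `δ₂` a walk of faces from the face `c₂ = (x_b, -m)`
just above the inner bottom side to a face at level `≤ -n - 1` (`-m + 1 ≤ x_t, x_b ≤ m - 2`), each
step of both crossing a primal edge which is not an edge of `P` and both of whose endpoints lie
off the hole `‖·‖_∞ ≤ m - 1`.  This is impossible: close `P` up through the hole along the row `0`
into a loop; the loop winds `0` around both starting faces (they are joined by the dual arms to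
faces above, resp. below, the loop), but moving the base face down the column `x_t`, along the
face row `-1` and down the column `x_b` from `c₁` to `c₂` crosses the loop exactly once (discrete
Jordan curve theorem by winding numbers, Kesten 1982, §2.2). [cite: KestenPTM1982, §2.2–2.3 (planar duality on the square lattice)] -/
theorem sqAnnulus_dualArmsTB_false {m n : ℕ} (hm : 2 ≤ m) (hmn : m ≤ n)
    {e w : Site 2} (P : (zdGraph 2).Walk e w) (hP : ∀ z ∈ P.support, z ∈ sqAnnulus m n)
    (he0 : e 0 = m) (he1 : |e 1| ≤ (m : ℤ) - 1) (hw0 : w 0 = -(m : ℤ)) (hw1 : |w 1| ≤ (m : ℤ) - 1)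
    {c₁ d₁ : Site 2} (δ₁ : (zdGraph 2).Walk c₁ d₁)
    (hc₁ : -(m : ℤ) + 1 ≤ c₁ 0 ∧ c₁ 0 ≤ (m : ℤ) - 2 ∧ c₁ 1 = (m : ℤ) - 1) (hd₁ : (n : ℤ) ≤ d₁ 1)
    (hδ₁ : ∀ dq ∈ δ₁.darts, sepEdge dq.fst dq.snd ∉ P.edges ∧
      ∀ v ∈ sepEdge dq.fst dq.snd, v ∉ box 2 (m - 1))
    {c₂ d₂ : Site 2} (δ₂ : (zdGraph 2).Walk c₂ d₂)
    (hc₂ : -(m : ℤ) + 1 ≤ c₂ 0 ∧ c₂ 0 ≤ (m : ℤ) - 2 ∧ c₂ 1 = -(m : ℤ)) (hd₂ : d₂ 1 + 1 ≤ -(n : ℤ))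
    (hδ₂ : ∀ dq ∈ δ₂.darts, sepEdge dq.fst dq.snd ∉ P.edges ∧
      ∀ v ∈ sepEdge dq.fst dq.snd, v ∉ box 2 (m - 1)) : False := by
  have hm1 : ((m - 1 : ℕ) : ℤ) = (m : ℤ) - 1 := by omega
  have habs_e := abs_le.1 he1
  -- coordinates of the sites of `P`
  have hPc : ∀ z ∈ P.support, (∀ i, -(n : ℤ) ≤ z i ∧ z i ≤ n) ∧
      ¬ ∀ i, -((m : ℤ) - 1) ≤ z i ∧ z i ≤ (m : ℤ) - 1 := by
    intro z hz
    have := hP z hz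
    simp only [sqAnnulus, Finset.mem_coe, mem_annulus, mem_box, hm1] at this
    exact this
  -- an edge with an endpoint in the hole is not an edge of `P`
  have hPe : ∀ ε ∈ P.edges, ∀ v ∈ ε, (∀ i, -((m : ℤ) - 1) ≤ v i ∧ v i ≤ (m : ℤ) - 1) → False :=
    fun ε hε v hv hvin => (hPc v (mem_support_of_mem_edges_of_mem P hε hv)).2 hvin
  -- the closing path and the loop
  obtain ⟨Γ, hΓs, hΓhole, hΓshape, hΓsum⟩ := exists_closingWalk_row hm hw0 hw1 he0 he1
  set L := P.append Γ with hL
  have hLtop : ∀ z ∈ L.support, z 1 ≤ n := by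
    intro z hz
    rw [hL, Walk.mem_support_append_iff] at hz
    rcases hz with hz | hz
    · exact ((hPc z hz).1 1).2
    · have := (hΓs z hz 1).2; omega
  have hLbot : ∀ z ∈ L.support, -(n : ℤ) ≤ z 1 := by
    intro z hz
    rw [hL, Walk.mem_support_append_iff] at hz
    rcases hz with hz | hz
    · exact ((hPc z hz).1 1).1
    · have := (hΓs z hz 1).1; omega
  have hLedges : ∀ ε ∈ L.edges,
      ε ∈ P.edges ∨ ∃ v ∈ ε, ∀ i, -((m : ℤ) - 1) ≤ v i ∧ v i ≤ (m : ℤ) - 1 := by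
    intro ε hε
    rw [hL, Walk.edges_append, List.mem_append] at hε
    rcases hε with hε | hε
    · exact Or.inl hε
    · exact Or.inr (hΓhole ε hε)
  -- an edge with an endpoint in the hole, not in `Γ`, is not in `L`
  have hLhole : ∀ (A B : Site 2), (∀ i, -((m : ℤ) - 1) ≤ A i ∧ A i ≤ (m : ℤ) - 1) →
      s(A, B) ∉ Γ.edges → s(A, B) ∉ L.edges := by
    intro A B hA hΓ hmem
    rw [hL, Walk.edges_append, List.mem_append] at hmem
    rcases hmem with hmem | hmem
    · exact hPe _ hmem A (Sym2.mem_mk_left _ _) hA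
    · exact hΓ hmem
  -- horizontal edges of the hole off the row `0`, columns `-m+1 … m-2`, are not edges of `Γ`
  have hΓh : ∀ A : Site 2, -(m : ℤ) + 1 ≤ A 0 → A 0 ≤ (m : ℤ) - 2 → A 1 ≠ 0 →
      s(A, A + Pi.single 0 1) ∉ Γ.edges := by
    intro A hA0 hA0' hA1 hmem
    rcases hΓshape _ hmem with ⟨v, hv, hvc⟩ | ⟨v, hv, -⟩
    · have hAv := mk_add_single_zero_eq_iff.1 hv
      subst hAv
      omega
    · exact mk_add_single_zero_ne_mk_add_single_one _ v hv
  -- vertical edges of the hole in the columns `-m+2 … m-2` are not edges of `Γ`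
  have hΓv : ∀ A : Site 2, -(m : ℤ) + 2 ≤ A 0 → A 0 ≤ (m : ℤ) - 2 →
      s(A, A + Pi.single 1 1) ∉ Γ.edges := by
    intro A hA0 hA0' hmem
    rcases hΓshape _ hmem with ⟨v, hv, -⟩ | ⟨v, hv, hvc⟩
    · exact mk_add_single_zero_ne_mk_add_single_one v A hv.symm
    · have hAv := mk_add_single_one_eq_iff.1 hv
      subst hAv
      omega
  -- the dual arms cross no edge of the loop
  have hcross : ∀ {c d : Site 2} (δ : (zdGraph 2).Walk c d),
      (∀ dq ∈ δ.darts, sepEdge dq.fst dq.snd ∉ P.edges ∧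
        ∀ v ∈ sepEdge dq.fst dq.snd, v ∉ box 2 (m - 1)) →
      ∀ dq ∈ δ.darts, sepEdge dq.fst dq.snd ∉ L.edges := by
    intro c d δ hδ dq hdq hmem
    rcases hLedges _ hmem with h | ⟨v, hv, hvin⟩
    · exact (hδ dq hdq).1 h
    · refine (hδ dq hdq).2 v hv ?_
      rw [mem_box, hm1]
      exact hvin
  -- winding number `0` at the starts of the two dual arms
  have hW₁ : walkWinding L c₁ = 0 := by
    rw [walkWinding_closed_eq_of_faceWalk L δ₁ (hcross δ₁ hδ₁)]
    exact walkWinding_eq_zero_of_le (N := n) hLtop hd₁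
  have hW₂ : walkWinding L c₂ = 0 := by
    rw [walkWinding_closed_eq_of_faceWalk L δ₂ (hcross δ₂ hδ₂)]
    exact walkWinding_eq_zero_of_ge (L := -(n : ℤ)) hLbot hd₂
  -- the base points inside the hole
  obtain ⟨uN, huN⟩ : ∃ uN : Site 2, uN = ![c₁ 0, 0] := ⟨_, rfl⟩
  obtain ⟨uS, huS⟩ : ∃ uS : Site 2, uS = ![c₁ 0, -1] := ⟨_, rfl⟩
  obtain ⟨uB, huB⟩ : ∃ uB : Site 2, uB = ![c₂ 0, -1] := ⟨_, rfl⟩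
  have huN0 : uN 0 = c₁ 0 := by simp [huN]
  have huN1 : uN 1 = 0 := by simp [huN]
  have huS0 : uS 0 = c₁ 0 := by simp [huS]
  have huS1 : uS 1 = -1 := by simp [huS]
  have huB0 : uB 0 = c₂ 0 := by simp [huB]
  have huB1 : uB 1 = -1 := by simp [huB]
  -- (A) climb the column `c₁ 0` from `uN` to `c₁`
  have hA : walkWinding L uN = walkWinding L c₁ := by
    obtain ⟨K, hK⟩ : ∃ K : ℕ, (K : ℤ) = (m : ℤ) - 1 := ⟨_, Int.toNat_of_nonneg (by omega)⟩
    have hend : uN + Pi.single 1 (K : ℤ) = c₁ := by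
      rw [Site.eq_iff_two]
      simp only [Pi.add_apply, huN0, huN1, single_one_int_apply_zero, single_one_int_apply_one,
        add_zero]
      constructor <;> first | trivial | omega
    rw [← hend]
    refine walkWinding_eq_climb L uN K fun j hj => hLhole _ _ ?_ ?_
    · have hj' : (j : ℤ) < K := by exact_mod_cast hj
      rw [Fin.forall_fin_two]
      simp only [Pi.add_apply, huN0, huN1, single_one_int_apply_zero, single_one_int_apply_one,
        add_zero]
      constructor <;> constructor <;> omega
    · refine hΓh _ ?_ ?_ ?_ <;>
        simp only [Pi.add_apply, huN0, huN1, single_one_int_apply_zero, single_one_int_apply_one,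
          add_zero] <;> omega
  -- (C) the crossing step from `uS` to `uN`
  have hC : walkWinding L uS = walkWinding L uN - 1 := by
    have hstep := walkWinding_sub_walkWinding_up_closed L uS
    have hN : uS + Pi.single 1 1 = uN := by
      rw [Site.eq_iff_two]
      simp only [Pi.add_apply, huS0, huS1, huN0, huN1, single_one_apply_zero, single_one_apply_one,
        add_zero]
      constructor <;> trivial
    rw [hN] at hstep
    have hsumP : (P.darts.map fun d => hCross uS d.fst d.snd).sum = 0 := by
      refine sum_hCross_eq_zero_of_notMem fun hmem => hPe _ hmem _ (Sym2.mem_mk_left _ _) ?_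
      rw [Fin.forall_fin_two]
      simp only [Pi.add_apply, huS0, huS1, single_one_apply_zero, single_one_apply_one, add_zero]
      constructor <;> constructor <;> omega
    have hsumΓ : (Γ.darts.map fun d => hCross uS d.fst d.snd).sum = 1 :=
      hΓsum uS (by omega) (by omega) (by omega)
    have hsumL : (L.darts.map fun d => hCross uS d.fst d.snd).sum = 1 := by
      rw [hL, Walk.darts_append, List.map_append, List.sum_append, hsumP, hsumΓ, zero_add]
    rw [hsumL] at hstep
    linarith
  -- (B) climb the column `c₂ 0` from `c₂` to `uB`
  have hB : walkWinding L c₂ = walkWinding L uB := by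
    obtain ⟨K, hK⟩ : ∃ K : ℕ, (K : ℤ) = (m : ℤ) - 1 := ⟨_, Int.toNat_of_nonneg (by omega)⟩
    have hend : c₂ + Pi.single 1 (K : ℤ) = uB := by
      rw [Site.eq_iff_two]
      simp only [Pi.add_apply, huB0, huB1, single_one_int_apply_zero, single_one_int_apply_one,
        add_zero]
      constructor <;> first | trivial | omega
    rw [← hend]
    refine walkWinding_eq_climb L c₂ K fun j hj => hLhole _ _ ?_ ?_
    · have hj' : (j : ℤ) < K := by exact_mod_cast hj
      rw [Fin.forall_fin_two]
      simp only [Pi.add_apply, single_one_int_apply_zero, single_one_int_apply_one, add_zero]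
      constructor <;> constructor <;> omega
    · have hj' : (j : ℤ) < K := by exact_mod_cast hj
      refine hΓh _ ?_ ?_ ?_ <;>
        simp only [Pi.add_apply, single_one_int_apply_zero, single_one_int_apply_one, add_zero] <;>
        omega
  -- (D) slide along the face row `-1` between `uB` and `uS`
  have hD : walkWinding L uB = walkWinding L uS := by
    rcases le_total (c₂ 0) (c₁ 0) with hle | hle
    · obtain ⟨K, hK⟩ : ∃ K : ℕ, (K : ℤ) = c₁ 0 - c₂ 0 := ⟨_, Int.toNat_of_nonneg (by omega)⟩
      have hend : uB + Pi.single 0 (K : ℤ) = uS := by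
        rw [Site.eq_iff_two]
        simp only [Pi.add_apply, huB0, huB1, huS0, huS1, single_zero_int_apply_zero,
          single_zero_int_apply_one, add_zero]
        constructor <;> first | trivial | omega
      rw [← hend]
      refine walkWinding_eq_slide L uB K fun j hj => hLhole _ _ ?_ ?_
      · have hj' : (j : ℤ) < K := by exact_mod_cast hj
        rw [Fin.forall_fin_two]
        simp only [Pi.add_apply, huB0, huB1, single_zero_int_apply_zero, single_zero_int_apply_one,
          add_zero]
        constructor <;> constructor <;> omega
      · have hj' : (j : ℤ) < K := by exact_mod_cast hj
        refine hΓv _ ?_ ?_ <;>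
          simp only [Pi.add_apply, huB0, single_zero_int_apply_zero] <;> omega
    · obtain ⟨K, hK⟩ : ∃ K : ℕ, (K : ℤ) = c₂ 0 - c₁ 0 := ⟨_, Int.toNat_of_nonneg (by omega)⟩
      have hend : uS + Pi.single 0 (K : ℤ) = uB := by
        rw [Site.eq_iff_two]
        simp only [Pi.add_apply, huB0, huB1, huS0, huS1, single_zero_int_apply_zero,
          single_zero_int_apply_one, add_zero]
        constructor <;> first | trivial | omega
      rw [← hend]
      refine (walkWinding_eq_slide L uS K fun j hj => hLhole _ _ ?_ ?_).symm
      · have hj' : (j : ℤ) < K := by exact_mod_cast hj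
        rw [Fin.forall_fin_two]
        simp only [Pi.add_apply, huS0, huS1, single_zero_int_apply_zero, single_zero_int_apply_one,
          add_zero]
        constructor <;> constructor <;> omega
      · have hj' : (j : ℤ) < K := by exact_mod_cast hj
        refine hΓv _ ?_ ?_ <;>
          simp only [Pi.add_apply, huS0, single_zero_int_apply_zero] <;> omega
  -- contradiction: `0 = W(c₁) = W(uN) = W(uS) + 1 = W(uB) + 1 = W(c₂) + 1 = 1`
  have : walkWinding L c₁ = walkWinding L c₂ + 1 := by
    rw [← hA, hB, hD, hC]; ring
  rw [hW₁, hW₂] at this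
  norm_num at this

/-- **Closed dual arms from the top and from the bottom of the hole separate the west inner side
from the east inner side** (percolation form of `sqAnnulus_dualArmsTB_false`).  For a lattice
configuration `ω` on `ℤ²` and `2 ≤ m ≤ n`: if there are a walk of faces from the face
`(x_t, m - 1)` below the inner top side to a face at level `≥ n` and a walk of faces from the face
`(x_b, -m)` above the inner bottom side to a face at level `≤ -n - 1` (`-m + 1 ≤ x_t, x_b ≤ m - 2`),
each step of which crosses an `ω`-CLOSED edge with both endpoints off the hole `‖·‖_∞ ≤ m - 1`,
then no site `e` of the inner east side (`e₀ = m`, `|e₁| ≤ m - 1`) is connected to a site `w` of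
the inner west side by an `ω`-open path of `A_{m,n}`.  This is the reading "two closed dual arms ⟹
two distinct open annulus-clusters" behind `zdFiveArmClusters` in the layout of
Kesten–Sidoravicius–Zhang's five-arm event (open arms left and right, closed arms up and down).
[cite: KestenPTM1982, §2.2–2.3 (planar duality on the square lattice)] [cite: Nolin2008, §4.1 (arm events and clusters)] -/
theorem not_openConnIn_sqAnnulus_of_dualArmsTB {m n : ℕ} (hm : 2 ≤ m) (hmn : m ≤ n)
    {ω : BondConfig (Site 2)} (hω : ω ⊆ (zdGraph 2).edgeSet)
    {e w : Site 2} (he0 : e 0 = m) (he1 : |e 1| ≤ (m : ℤ) - 1)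
    (hw0 : w 0 = -(m : ℤ)) (hw1 : |w 1| ≤ (m : ℤ) - 1)
    {c₁ d₁ : Site 2} (δ₁ : (zdGraph 2).Walk c₁ d₁)
    (hc₁ : -(m : ℤ) + 1 ≤ c₁ 0 ∧ c₁ 0 ≤ (m : ℤ) - 2 ∧ c₁ 1 = (m : ℤ) - 1) (hd₁ : (n : ℤ) ≤ d₁ 1)
    (hδ₁ : ∀ dq ∈ δ₁.darts, sepEdge dq.fst dq.snd ∉ ω ∧
      ∀ v ∈ sepEdge dq.fst dq.snd, v ∉ box 2 (m - 1))
    {c₂ d₂ : Site 2} (δ₂ : (zdGraph 2).Walk c₂ d₂)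
    (hc₂ : -(m : ℤ) + 1 ≤ c₂ 0 ∧ c₂ 0 ≤ (m : ℤ) - 2 ∧ c₂ 1 = -(m : ℤ)) (hd₂ : d₂ 1 + 1 ≤ -(n : ℤ))
    (hδ₂ : ∀ dq ∈ δ₂.darts, sepEdge dq.fst dq.snd ∉ ω ∧
      ∀ v ∈ sepEdge dq.fst dq.snd, v ∉ box 2 (m - 1)) :
    ω ∉ openConnIn (sqAnnulus m n) e w := by
  intro h
  obtain ⟨P, hPs, hPe⟩ := exists_walk_of_mem_openConnIn hω h
  exact sqAnnulus_dualArmsTB_false hm hmn P hPs he0 he1 hw0 hw1 δ₁ hc₁ hd₁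
    (fun dq hdq => ⟨fun hmem => (hδ₁ dq hdq).1 (hPe _ hmem), (hδ₁ dq hdq).2⟩) δ₂ hc₂ hd₂
    (fun dq hdq => ⟨fun hmem => (hδ₂ dq hdq).1 (hPe _ hmem), (hδ₂ dq hdq).2⟩)

/-- The same separation read from the west side: `ω ∉ {w ↔ e in A_{m,n}}`. [folklore] -/
theorem not_openConnIn_sqAnnulus_of_dualArmsTB' {m n : ℕ} (hm : 2 ≤ m) (hmn : m ≤ n)
    {ω : BondConfig (Site 2)} (hω : ω ⊆ (zdGraph 2).edgeSet)
    {e w : Site 2} (he0 : e 0 = m) (he1 : |e 1| ≤ (m : ℤ) - 1)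
    (hw0 : w 0 = -(m : ℤ)) (hw1 : |w 1| ≤ (m : ℤ) - 1)
    {c₁ d₁ : Site 2} (δ₁ : (zdGraph 2).Walk c₁ d₁)
    (hc₁ : -(m : ℤ) + 1 ≤ c₁ 0 ∧ c₁ 0 ≤ (m : ℤ) - 2 ∧ c₁ 1 = (m : ℤ) - 1) (hd₁ : (n : ℤ) ≤ d₁ 1)
    (hδ₁ : ∀ dq ∈ δ₁.darts, sepEdge dq.fst dq.snd ∉ ω ∧
      ∀ v ∈ sepEdge dq.fst dq.snd, v ∉ box 2 (m - 1))
    {c₂ d₂ : Site 2} (δ₂ : (zdGraph 2).Walk c₂ d₂)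
    (hc₂ : -(m : ℤ) + 1 ≤ c₂ 0 ∧ c₂ 0 ≤ (m : ℤ) - 2 ∧ c₂ 1 = -(m : ℤ)) (hd₂ : d₂ 1 + 1 ≤ -(n : ℤ))
    (hδ₂ : ∀ dq ∈ δ₂.darts, sepEdge dq.fst dq.snd ∉ ω ∧
      ∀ v ∈ sepEdge dq.fst dq.snd, v ∉ box 2 (m - 1)) :
    ω ∉ openConnIn (sqAnnulus m n) w e := by
  rw [← openConnIn_comm]
  exact not_openConnIn_sqAnnulus_of_dualArmsTB hm hmn hω he0 he1 hw0 hw1 δ₁ hc₁ hd₁ hδ₁ δ₂ hc₂ hd₂ hδ₂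

end BarrierTB





end Literature.Probability.Percolation
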